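import Summits.AtomisticToContinuum.HydrodynamicLimit.Theorems.BoxDissipativeWeakStrongFluxClosureEqHomogeneousPrelim
import Summits.AtomisticToContinuum.HydrodynamicLimit.Theorems.BoxDissipativeWeakStrongFluxClosureEqHomogeneous
import Summits.AtomisticToContinuum.HydrodynamicLimit.Theorems.BoxDissipativeWeakStrongFluxClosureOfParts
import HarnessLib

/-!
# A.e.-measurability of the crux defect functional under the local Gibbs law
— wave-2 piece W2d `defect_aemeasurable` of line `registered`, crux `FluxClosure`
(route `BoxDissipativeWeakStrong`, item stmt-AtomisticToContinuum-9902)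

Support file (`--supports stmt-AtomisticToContinuum-9902`) of the lead prover of the crux
`Summit.AtomisticToContinuum.HydrodynamicLimit.Theses.BoxDissipativeWeakStrong.FluxClosure`.

For `N + 1` hard spheres of reduced diameter `σ` on `𝕋³` with flow `Φ N`, a kinetic window `ℓ N` and the
cube kernel `K_ℓ(x, y) = ℓ⁻³ 𝟙[∀ i, ‖yᵢ - xᵢ‖ < ℓ/2]`, the crux's pathwise momentum-balance DEFECT of the
box fields `ρ̂, m̂, Ê` of the evolved configuration `Φ_t z`,
`D_N(z) = ∫⟪m̂(Φ_τ z), w τ⟫ − ∫⟪m̂(Φ_0 z), w 0⟫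
  − ∫_{(0,τ]} ∫ (⟪m̂, ∂ₜw⟫ + Σᵢⱼ (m̂ᵢm̂ⱼ/ρ̂) ∂ⱼwᵢ + ρ̂θ̂ Z(min(ρ̂σ³, η₁)) div w) dx dt`
(`θ̂ = ⅔(Ê/ρ̂ − ‖m̂‖²/(2ρ̂²))`, `w` smooth on the slab `[0,T) × 𝕋³`, `τ ∈ [0,T)`), is a.e.-measurable for
the local Gibbs law `P_N = localGibbsLaw σ a₀ u₀ θ₀ N (Φ N)`, for every `N` and all profile functions
(`defect_aemeasurable`, the registered signature). This is the measurability input of the wave-2 format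
lemmas ("in `P_N`-probability ⇒ in `L¹(P_N)`") for the collisional deviation and for the defect itself.

Outline. (1) The two boundary pairings `z ↦ ∫⟪m̂(Φ_t z)(x), w t x⟫ dx` (`t = τ, 0`) are MEASURABLE: the box
momentum is jointly measurable in (configuration, point) (`FluxClosureB5.measurable_momentum`), the flow map at
a fixed time is measurable, the slice `w t` is smooth hence measurable, and Fubini measurability
(`FluxClosureEq.E8.E8_measurable_pairing`). (2) The interior time–space integral is `P_N`-a.e. measurable by
`FluxClosureEq.E8.E8_aemeasurable_tsIntegral` (laws carried by the good set; the flow is jointly measurable on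
`good × ℝ`), once its integrand — as a function of `((t, c), x)` — is shown to agree on `t ∈ (0, τ]` with a
jointly measurable function: the box fields are jointly measurable in `(c, x)` (`FluxClosureB5.measurable_*`),
and ALL the derivatives of the test field (`∂ₜw`, `∂ₖwⱼ`, `div w = Σᵢ ∂ᵢwᵢ`) are evaluations of one
measurable field `H` of continuous linear maps on `ℝ × 𝕋³` (`FluxClosureB4.exists_measurable_fderiv`) for
`t ∈ [0, T) ⊇ (0, τ]` (`W2d_aemeasurable_interior`, abstract jointly measurable kernel). (3) `P_N` is a density
against the Liouville measure (`particleLaw_eq`), hence carried by the good set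
(`HardSphereFlow.measure_compl_good`); combine by `AEMeasurable.sub`.

References: H. Spohn, *Large Scale Dynamics of Interacting Particles* (1991), Part I §3.2–3.3;
C. Cercignani, R. Illner, M. Pulvirenti, *The Mathematical Theory of Dilute Gases* (1994), §4.2.
-/

noncomputable section

namespace Summit.AtomisticToContinuum.HydrodynamicLimit.Theorems
namespace FluxClosureFmt.W2d

open scoped BigOperators Topology Classical MeasureTheory ProbabilityTheory InnerProductSpace ENNReal
open Filter Set Function MeasureTheory
open Literature.MathematicalPhysics.KineticTheory Literature.Analysis.FluidPDE Literature.Analysis.FunctionSpaces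
open Summit.AtomisticToContinuum.HydrodynamicLimit.Theses.BoxDissipativeWeakStrong

variable {n : ℕ}

/-! ## The interior time–space integral (abstract kernel) -/

/-- **A.e.-measurability of the interior time–space integral of the defect** (abstract jointly measurable
kernel `k`). For a hard-sphere flow `Ψ` on `𝕋³`, a law `μ` carried by its good set, `τ ∈ [0, T)` and a test
field `w` smooth on `[0,T) × 𝕋³`, the functional
`z ↦ ∫_{(0,τ]} ∫ (⟪m̂, ∂ₜw⟫ + Σᵢⱼ (m̂ᵢm̂ⱼ/ρ̂) ∂ⱼwᵢ + ρ̂θ̂ Z(min(ρ̂σ³, η₁)) div w)(Ψ_t z, x) dx dt`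
is `μ`-a.e. measurable: its integrand agrees on `(0, τ]` with a jointly measurable function of `((t, c), x)`
built from the jointly measurable box fields and the measurable space–time derivative field of
`FluxClosureB4.exists_measurable_fderiv`; conclude by `FluxClosureEq.E8.E8_aemeasurable_tsIntegral`. [folklore] -/
theorem W2d_aemeasurable_interior {ε : ℝ} (Ψ : HardSphereFlow (Torus.geometry (Fin 3)) ε n)
    {k : T3 → T3 → ℝ} (hk : Measurable fun p : T3 × T3 => k p.1 p.2) {T τ : ℝ} (hτ : τ ∈ Ico 0 T)
    {w : ℝ → T3 → V3} (hw : Torus.IsSmoothSpaceTimeOn (Ico 0 T) w)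
    {μ : Measure (Config n (Fin 3) T3)} (hμ : μ Ψ.goodᶜ = 0) (σ η₁ : ℝ) :
    AEMeasurable (fun z : Config n (Fin 3) T3 => ∫ t in Ioc 0 τ, ∫ x,
      (inner ℝ (empiricalMomentumField (Ψ.flow t z) (k x)) (Torus.timeDerivWithin (Ico 0 T) w t x) +
      (∑ i, ∑ j, empiricalMomentumField (Ψ.flow t z) (k x) i * empiricalMomentumField (Ψ.flow t z) (k x) j /
        empiricalDensityField (Ψ.flow t z) (k x) * Torus.partialDeriv j (fun y => w t y i) x) +
      empiricalDensityField (Ψ.flow t z) (k x) *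
        (2 / 3 * (empiricalEnergyField (Ψ.flow t z) (k x) / empiricalDensityField (Ψ.flow t z) (k x) -
          ‖empiricalMomentumField (Ψ.flow t z) (k x)‖ ^ 2 / (2 * empiricalDensityField (Ψ.flow t z) (k x) ^ 2))) *
        hsCompressibility (min (empiricalDensityField (Ψ.flow t z) (k x) * σ ^ 3) η₁) *
        Torus.divergence (w t) x)) μ := by
  obtain ⟨H, -, hHm, hHt, hHs, -⟩ := FluxClosureB4.exists_measurable_fderiv hτ.2 hw
  -- opaque names for the jointly measurable box fields and the derivative fields
  obtain ⟨Mf, hMf⟩ : ∃ Mf : Config n (Fin 3) T3 × T3 → V3, Mf = fun p => empiricalMomentumField p.1 (k p.2) :=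
    ⟨_, rfl⟩
  obtain ⟨Df, hDf⟩ : ∃ Df : Config n (Fin 3) T3 × T3 → ℝ, Df = fun p => empiricalDensityField p.1 (k p.2) :=
    ⟨_, rfl⟩
  obtain ⟨Ef, hEf⟩ : ∃ Ef : Config n (Fin 3) T3 × T3 → ℝ, Ef = fun p => empiricalEnergyField p.1 (k p.2) :=
    ⟨_, rfl⟩
  obtain ⟨A, hA⟩ : ∃ A : ℝ × T3 → V3, A = fun p => H p (1, 0) := ⟨_, rfl⟩
  obtain ⟨B, hB⟩ : ∃ B : Fin 3 → Fin 3 → ℝ × T3 → ℝ,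
      B = fun a b p => H p (0, EuclideanSpace.single a 1) b := ⟨_, rfl⟩
  have mM : Measurable Mf := hMf ▸ FluxClosureB5.measurable_momentum (n := n) (K := k) hk
  have mD : Measurable Df := hDf ▸ FluxClosureB5.measurable_density (n := n) (K := k) hk
  have mE : Measurable Ef := hEf ▸ FluxClosureB5.measurable_energy (n := n) (K := k) hk
  have mA : Measurable A := hA ▸ hHm.apply_continuousLinearMap _
  have mB : ∀ a b, Measurable (B a b) := fun a b => by
    rw [hB]
    exact (show Measurable fun v : V3 => v b by fun_prop).comp (hHm.apply_continuousLinearMap _)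
  have mhs : Measurable hsCompressibility := measurable_const.add (measurable_id.mul (measurable_deriv _))
  have hπ : Measurable fun q : (ℝ × Config n (Fin 3) T3) × T3 => (q.1.2, q.2) :=
    measurable_fst.snd.prodMk measurable_snd
  have hπ' : Measurable fun q : (ℝ × Config n (Fin 3) T3) × T3 => (q.1.1, q.2) :=
    measurable_fst.fst.prodMk measurable_snd
  have mD' := mD.comp hπ
  have mE' := mE.comp hπ
  have mM' := mM.comp hπ
  have mMi : ∀ i, Measurable fun q : (ℝ × Config n (Fin 3) T3) × T3 => Mf (q.1.2, q.2) i := fun i =>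
    (show Measurable fun v : V3 => v i by fun_prop).comp mM'
  -- the three jointly measurable pieces of the integrand
  have hF₁ : Measurable fun q : (ℝ × Config n (Fin 3) T3) × T3 => ⟪Mf (q.1.2, q.2), A (q.1.1, q.2)⟫_ℝ :=
    mM'.inner (mA.comp hπ')
  have hF₂ : Measurable fun q : (ℝ × Config n (Fin 3) T3) × T3 =>
      ∑ i, ∑ j, Mf (q.1.2, q.2) i * Mf (q.1.2, q.2) j / Df (q.1.2, q.2) * B j i (q.1.1, q.2) :=
    Finset.measurable_sum _ fun i _ => Finset.measurable_sum _ fun j _ =>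
      (((mMi i).mul (mMi j)).div mD').mul ((mB j i).comp hπ')
  have hF₃ : Measurable fun q : (ℝ × Config n (Fin 3) T3) × T3 =>
      Df (q.1.2, q.2) * (2 / 3 * (Ef (q.1.2, q.2) / Df (q.1.2, q.2) -
        ‖Mf (q.1.2, q.2)‖ ^ 2 / (2 * Df (q.1.2, q.2) ^ 2))) *
        hsCompressibility (min (Df (q.1.2, q.2) * σ ^ 3) η₁) * ∑ i, B i i (q.1.1, q.2) :=
    ((mD'.mul (((mE'.div mD').sub ((mM'.norm.pow_const 2).div ((mD'.pow_const 2).const_mul 2))).const_mul _)).mul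
      (mhs.comp ((mD'.mul_const _).min measurable_const))).mul (Finset.measurable_sum _ fun i _ => (mB i i).comp hπ')
  have hIoc : ∀ t ∈ Ioc 0 τ, t ∈ Ico 0 T := fun t ht => ⟨ht.1.le, lt_of_le_of_lt ht.2 hτ.2⟩
  refine FluxClosureEq.E8.E8_aemeasurable_tsIntegral Ψ
    (f := fun t c x =>
      (inner ℝ (empiricalMomentumField c (k x)) (Torus.timeDerivWithin (Ico 0 T) w t x) +
      (∑ i, ∑ j, empiricalMomentumField c (k x) i * empiricalMomentumField c (k x) j /
        empiricalDensityField c (k x) * Torus.partialDeriv j (fun y => w t y i) x) +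
      empiricalDensityField c (k x) *
        (2 / 3 * (empiricalEnergyField c (k x) / empiricalDensityField c (k x) -
          ‖empiricalMomentumField c (k x)‖ ^ 2 / (2 * empiricalDensityField c (k x) ^ 2))) *
        hsCompressibility (min (empiricalDensityField c (k x) * σ ^ 3) η₁) * Torus.divergence (w t) x))
    ((hF₁.add hF₂).add hF₃) (τ := τ) (fun t ht c x => ?_) hμ
  simp only [Pi.add_apply, hMf, hDf, hEf, hA, hB, Torus.divergence, hHt t (hIoc t ht) x, hHs t (hIoc t ht) x]

/-! ## The stub -/

/-- **Wave-2 piece W2d of line `registered` (crux `FluxClosure`)**: the crux's pathwise momentum-balance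
defect `D_N(z) = ∫⟪m̂(Φ_τ z), w τ⟫ − ∫⟪m̂(Φ_0 z), w 0⟫ − ∫_{(0,τ]} ∫ (⟪m̂, ∂ₜw⟫ + Σᵢⱼ (m̂ᵢm̂ⱼ/ρ̂) ∂ⱼwᵢ
+ p_cut div w)` of the box fields (cube kernel at window `ℓ_N`, `p_cut = ρ̂θ̂ Z(min(ρ̂σ³, η₁))`) along the
hard-sphere flow `Φ N` is a.e.-measurable under the local Gibbs law `localGibbsLaw σ a₀ u₀ θ₀ N (Φ N)`, for
every `N`, every `τ ∈ [0,T)` and every `w` smooth on `[0,T) × 𝕋³`. Proof: the boundary pairings are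
measurable (`FluxClosureEq.E8.E8_measurable_pairing` with the smooth slices `w τ`, `w 0`), the interior
integral is a.e.-measurable (`W2d_aemeasurable_interior`, the law being carried by the good set since
`localGibbsLaw = particleLaw ≪ liouville`), and `AEMeasurable.sub`. -/
theorem defect_aemeasurable : ∀ (σ η₁ T : ℝ) (a₀ θ₀ : T3 → ℝ) (u₀ : T3 → V3) (Φ : (N : ℕ) → HardSphereFlow (Torus.geometry (Fin 3)) (hsDiameter σ N) (N + 1)) (ℓ : ℕ → ℝ), (∀ N, 0 < ℓ N ∧ ℓ N ≤ 1) → let K := fun (l : ℝ) (x y : T3) => indicator {y' : T3 | ∀ i, ‖y' i - x i‖ < l / 2} (fun _ => (l ^ 3)⁻¹) y; let Dn := fun N t z x => empiricalDensityField ((Φ N).flow t z) (K (ℓ N) x); let Mm := fun N t z x => empiricalMomentumField ((Φ N).flow t z) (K (ℓ N) x); let En := fun N t z x => empiricalEnergyField ((Φ N).flow t z) (K (ℓ N) x); let Th := fun (r : ℝ) (m : V3) (E : ℝ) => 2 / 3 * (E / r - ‖m‖ ^ 2 / (2 * r ^ 2)); let Zc := fun η : ℝ => hsCompressibility (min η η₁);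 let Pc := fun r ϑ : ℝ => r * ϑ * Zc (r * σ ^ 3); ∀ τ ∈ Ico 0 T, ∀ w : ℝ → T3 → V3, Torus.IsSmoothSpaceTimeOn (Ico 0 T) w → ∀ N : ℕ, AEMeasurable (fun z : Config (N + 1) (Fin 3) T3 => (∫ x, inner ℝ (Mm N τ z x) (w τ x)) - (∫ x, inner ℝ (Mm N 0 z x) (w 0 x)) - ∫ t in Ioc 0 τ, ∫ x, (inner ℝ (Mm N t z x) (Torus.timeDerivWithin (Ico 0 T) w t x) + (∑ i, ∑ j, Mm N t z x i * Mm N t z x j / Dn N t z x * Torus.partialDeriv j (fun y => w t y i) x) + Pc (Dn N t z x) (Th (Dn N t z x) (Mm N t z x) (En N t z x)) * Torus.divergence (w t) x)) (localGibbsLaw σ a₀ u₀ θ₀ N (Φ N)) := by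
  intro σ η₁ T a₀ θ₀ u₀ Φ ℓ _hℓ
  dsimp only
  intro τ hτ w hw N
  have h0T : (0 : ℝ) ∈ Ico 0 T := ⟨le_rfl, hτ.1.trans_lt hτ.2⟩
  -- the cube kernel (named once, passed explicitly) is jointly measurable; the law is carried by the good set
  set k : T3 → T3 → ℝ := fun x y => {y' : T3 | ∀ i, ‖y' i - x i‖ < ℓ N / 2}.indicator (fun _ => (ℓ N ^ 3)⁻¹) y
    with hkdef
  have hk : Measurable fun p : T3 × T3 => k p.1 p.2 := LGFS.measurable_boxK_uncurry (ℓ N)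
  have hμ : localGibbsLaw σ a₀ u₀ θ₀ N (Φ N) (Φ N).goodᶜ = 0 := by
    have hac : localGibbsLaw σ a₀ u₀ θ₀ N (Φ N) ≪
        liouville (Torus.geometry (Fin 3)) (N + 1) (hsDiameter σ N) := by
      rw [localGibbsLaw, particleLaw_eq]
      exact withDensity_absolutelyContinuous _ _
    exact hac (Φ N).measure_compl_good
  have hA := FluxClosureEq.E8.E8_measurable_pairing (Φ N) τ (k := k) hk
    (hw.isSmooth_slice hτ).continuous.measurable
  have hB := FluxClosureEq.E8.E8_measurable_pairing (Φ N) 0 (k := k) hk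
    (hw.isSmooth_slice h0T).continuous.measurable
  have hI := W2d_aemeasurable_interior (Φ N) (k := k) hk hτ hw hμ σ η₁
  exact (hA.aemeasurable.sub hB.aemeasurable).sub hI

end FluxClosureFmt.W2d
end Summit.AtomisticToContinuum.HydrodynamicLimit.Theorems

end
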